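import Literature.AlgebraicGeometry.ComplexMultiplication.CyclicTwoPowerCMTypes
import Literature.NumberTheory.NumberFields.RootOfUnityMonomials
import HarnessLib

/-!
# CM fields with cyclic Galois group of order `2^{a+1} q` (`q` an odd prime): every PRIMITIVE CM type is
# nondegenerate — the Hodge conjecture for all powers of every SIMPLE abelian variety with CM by such a field

COR-CM (cell `pub-hodgecm2`), binder seat b04 (gen 11), count-neutral; sequel of `CorCM/CyclicTwoPowerCMTypes`
(`q = 1`: cyclic `2`-groups, ALL types nondegenerate) with the linear algebra of `CorCM/RootOfUnityMonomials`.
KERNEL ONLY: theorems; no definition, no named fact, no `sorry`.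

THEOREM (`isNondegenerate_of_isPrimitive_of_isCyclic`).  Let `K` be a CM field, normal over `ℚ`, with CYCLIC Galois
group of order `[K:ℚ] = 2^{a+1} q`, `q` an odd prime (e.g. `ℚ(ζ_p)` for every prime `p` with `p - 1 = 2^{a+1} q`:
`7, 11, 13, 23, 29, 41, 47, 53, 59, 83, 89, 97, 107, 113, 137, 149, …`).  Then every PRIMITIVE CM type of `K` is
NONDEGENERATE; hence every SIMPLE abelian variety with CM by `K` satisfies `Bᵐ(Aⁿ) ⊗ ℂ = Dᵐ(Aⁿ) ⊗ ℂ` and the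
Hodge conjecture together with all its powers, UNCONDITIONALLY (`hodgeConjectureFor_pow_of_isSimple_of_isCyclic`).
(The hypothesis "ONE odd prime" is sharp: `ℚ(ζ₁₉)` (`18 = 2·3²`, Serre) and `ℚ(ζ₆₇)` (`66 = 2·3·11`, Ribet) carry
primitive degenerate types — tree file `Pohlmann1968/DegenerateCMTypesRibetLenstraSerre`.)

PROOF.  Kubota's Lemma 2 (`Pohlmann1968.isNondegenerate_iff_forall_oddCharacters`): no odd character `χ` may vanish
on `Φ' = {g | σ_g ∈ Φ} ⊆ G`.  With `γ` a generator, `γ₂ = γ^q` (order `2m = 2^{a+1}`), `γ_q = γ^{2m}` (order `q`),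
`G = {γ₂^r γ_q^s}`, the involution is `ρ = γ₂^m`, `ω = χ(γ₂)` has `ω^m = -1`, `ζ = χ(γ_q)` has `ζ^q = 1`, and
`Σ_{Φ'} χ = Σ_{r<m, s<q} ε_{rs} ω^r ζ^s` with ALL `ε_{rs} = ±1` (`Φ'` contains exactly one of `g, ρg`).  If `ζ = 1`
the coefficient of `ω^r` is a sum of `q` signs, odd, and `Σ_{r<m} c_r ω^r ≠ 0` (`X^m + 1` is the minimal polynomial of
`ω`).  If `ζ ≠ 1` it is a primitive `q`-th root of unity and `forall_eq_of_sum_monomials_eq_zero` (linear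
disjointness of `ℚ(ζ_{2m})`, `ℚ(ζ_q)`) forces `ε_{rs}` to be independent of `s`: `Φ'` is stable under `γ_q ≠ 1`, so
`1` and `γ_q` have the same translates-pattern — contradicting PRIMITIVITY (Shimura §8.2 Prop. 26, transported
to `Gal(K/ℚ)` in `separating_gal_of_isPrimitive`).

## References

* [Kubota1965] T. Kubota, Trans. AMS 118 (1965), §4 Lemma 2.
* [Shimura1998] G. Shimura, *Abelian Varieties with Complex Multiplication and Modular Functions*, §8.1, §8.2 Prop. 26.
* [Gordon1999HodgeAVSurvey] B. B. Gordon, *A survey of the Hodge conjecture for abelian varieties*, Prop. 9.4.1,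
  §9.4.2 (Ribet, Lenstra, Serre examples), Thm. 6.4.
* [Washington1997] L. C. Washington, *Introduction to Cyclotomic Fields*, Prop. 2.4, Thm. 2.5.

Provenance: Literature home (namespace `Literature.AlgebraicGeometry.ComplexMultiplication.CyclicTwoPower`) of the Summits-side `CorCM/CyclicTimesPrimeCMTypes` (cell `pub-hodgecm2`, COR-CM; all its imports are `Literature/`, Mathlib and the already re-homed `CyclicTwoPowerCMTypes`, `RootOfUnityMonomials`), which `Literature/` may not import; theorems only, no named fact, no definition. Nothing here bears on `HC_CM`. Lane `lit-hodgefound` (Layer A3: CM types, their Kubota ranks and Galois combinatorics), seat p20.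
-/

noncomputable section

open _root_.CategoryTheory _root_.CategoryTheory.Limits NumberField Polynomial

namespace Literature.AlgebraicGeometry.ComplexMultiplication.CyclicTwoPower

open Literature.NumberTheory.NumberFields.RootOfUnityMonomials

open Literature.NumberTheory.ComplexMultiplication
open Literature.AlgebraicGeometry.Motives (AbelianVariety CMType)
open Literature.AlgebraicGeometry.HodgeTheory
open Literature.AlgebraicGeometry.ComplexMultiplication (IsCMTypeRealisation isSimple_iff_isPrimitive)
open Literature.AlgebraicGeometry.VanGeemen1994 (hodgeClassSpan)
open Literature.Barriers.HodgeConjecture (divisorClassesSpan)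
open Literature.AlgebraicGeometry.Pohlmann1968

/-! ### §1 Group level: odd characters of a cyclic group of order `2^{a+1} q` on a primitive CM type -/

section Group

variable {G : Type*} [Group G] [Fintype G] [DecidableEq G]

omit [Fintype G] [DecidableEq G] in
/-- Exponent uniqueness: `γ^{q r + 2m s} = γ^{q r' + 2m s'}` with `r, r' < 2m`, `s, s' < q` forces `r = r'`,
`s = s'` (`ord γ = 2mq`, `gcd(2m, q) = 1`). [cite: Kubota1965, §4 Lemma 2] -/
theorem exponents_eq_of_pow_eq {γ : G} {m q : ℕ} (hγ : orderOf γ = 2 * m * q) (hcop : (2 * m).Coprime q)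
    {r r' s s' : ℕ} (hr : r < 2 * m) (hr' : r' < 2 * m) (hs : s < q) (hs' : s' < q)
    (h : γ ^ (q * r + 2 * m * s) = γ ^ (q * r' + 2 * m * s')) : r = r' ∧ s = s' := by
  rw [pow_eq_pow_iff_modEq, hγ] at h
  constructor
  · -- reduce mod `2m`
    have h2 : q * r + 2 * m * s ≡ q * r' + 2 * m * s' [MOD 2 * m] := Nat.ModEq.of_mul_right q h
    have h3 : q * r ≡ q * r' [MOD 2 * m] := by
      have e1 : q * r + 2 * m * s ≡ q * r [MOD 2 * m] := by
        conv_rhs => rw [← add_zero (q * r)]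
        exact Nat.ModEq.add_left _ (Nat.modEq_zero_iff_dvd.2 ⟨s, rfl⟩)
      have e2 : q * r' + 2 * m * s' ≡ q * r' [MOD 2 * m] := by
        conv_rhs => rw [← add_zero (q * r')]
        exact Nat.ModEq.add_left _ (Nat.modEq_zero_iff_dvd.2 ⟨s', rfl⟩)
      exact (e1.symm.trans h2).trans e2
    exact Nat.ModEq.eq_of_lt_of_lt (Nat.ModEq.cancel_left_of_coprime hcop h3) hr hr'
  · -- reduce mod `q`
    have h2 : q * r + 2 * m * s ≡ q * r' + 2 * m * s' [MOD q] := Nat.ModEq.of_mul_left (2 * m) h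
    have h3 : 2 * m * s ≡ 2 * m * s' [MOD q] := by
      have e1 : q * r + 2 * m * s ≡ 2 * m * s [MOD q] := by
        conv_rhs => rw [← zero_add (2 * m * s)]
        exact Nat.ModEq.add_right _ (Nat.modEq_zero_iff_dvd.2 ⟨r, rfl⟩)
      have e2 : q * r' + 2 * m * s' ≡ 2 * m * s' [MOD q] := by
        conv_rhs => rw [← zero_add (2 * m * s')]
        exact Nat.ModEq.add_right _ (Nat.modEq_zero_iff_dvd.2 ⟨r', rfl⟩)
      exact (e1.symm.trans h2).trans e2
    exact Nat.ModEq.eq_of_lt_of_lt (Nat.ModEq.cancel_left_of_coprime hcop.symm h3) hs hs'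

/-- `P(ω) ≠ 0` for a non-zero rational polynomial of degree `< m` and `ω^m = -1`, `m = 2^a` (`X^m + 1 = Φ_{2m}` is
the minimal polynomial of `ω`). [cite: Kubota1965, §4 Lemma 2] -/
theorem aeval_ne_zero_of_pow_eq_neg_one {ω : ℂ} {m a : ℕ} (hm : m = 2 ^ a) (hω : ω ^ m = -1) {P : ℚ[X]}
    (hP0 : P ≠ 0) (hPdeg : P.natDegree < m) : aeval ω P ≠ 0 := by
  have hm0 : 0 < m := by rw [hm]; positivity
  have hcyc : cyclotomic (2 ^ (a + 1)) ℚ = X ^ m + 1 := by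
    rw [cyclotomic_prime_pow_eq_geom_sum Nat.prime_two, Finset.sum_range_succ, Finset.sum_range_one, pow_zero,
      pow_one, add_comm, hm]
  have hroot : aeval ω (cyclotomic (2 ^ (a + 1)) ℚ) = 0 := by
    rw [hcyc, map_add, map_pow, aeval_X, map_one, hω, neg_add_cancel]
  have hmin : minpoly ℚ ω = X ^ m + 1 := by
    rw [← hcyc]
    exact (minpoly.eq_of_irreducible_of_monic (cyclotomic.irreducible_rat (by positivity)) hroot
      (cyclotomic.monic _ _)).symm
  intro h0
  have hle := minpoly.degree_le_of_ne_zero ℚ ω hP0 h0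
  rw [hmin, show (X ^ m + 1 : ℚ[X]) = X ^ m + C 1 by rw [C_1], degree_X_pow_add_C hm0] at hle
  have hlt : P.degree < (m : WithBot ℕ) := degree_le_natDegree.trans_lt (by exact_mod_cast hPdeg)
  exact absurd hle (not_le.2 hlt)

/-- A sum of an odd number of signs `±1` is not zero. [cite: Kubota1965, §4 Lemma 2] -/
theorem sum_signs_ne_zero {q : ℕ} (hq : Odd q) (ε : ℕ → ℚ) (hε : ∀ s, ε s = 1 ∨ ε s = -1) :
    ∑ s ∈ Finset.range q, ε s ≠ 0 := by
  -- integer version, read mod `2`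
  have hint : ∀ s, ∃ z : ℤ, (z : ℚ) = ε s ∧ ((z : ZMod 2) = 1) := fun s => by
    rcases hε s with h | h
    · exact ⟨1, by rw [h]; norm_num, by norm_num⟩
    · exact ⟨-1, by rw [h]; norm_num, by decide⟩
  choose z hz hz2 using hint
  intro h0
  have h1 : ((∑ s ∈ Finset.range q, z s : ℤ) : ℚ) = 0 := by
    rw [Int.cast_sum]; simpa only [hz] using h0
  have h2 : (∑ s ∈ Finset.range q, z s : ℤ) = 0 := by exact_mod_cast h1
  have h3 : ((∑ s ∈ Finset.range q, z s : ℤ) : ZMod 2) = (q : ZMod 2) := by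
    rw [Int.cast_sum]
    simp only [hz2, Finset.sum_const, Finset.card_range, nsmul_eq_mul, mul_one]
  rw [h2, Int.cast_zero, ZMod.natCast_eq_one_iff_odd.2 hq] at h3
  exact zero_ne_one h3

/-- **No odd character vanishes on a PRIMITIVE CM type of a cyclic group of order `2^{a+1} q`, `q` an odd prime.**
[cite: Kubota1965, §4 Lemma 2] [cite: Shimura1998, §8.2 Prop. 26] -/
theorem sum_ne_zero_of_orderOf_eq_two_pow_mul_prime {γ ρ : G} {a q : ℕ} (hq : q.Prime) (hq2 : q ≠ 2)
    (hγ : orderOf γ = 2 ^ (a + 1) * q) (hgen : ∀ x : G, x ∈ Submonoid.powers γ) {Φ : Finset G}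
    (hΦ : IsCMTypeWith ρ (Φ : Set G)) (hprim : ∀ x y : G, (∀ g : G, g * x ∈ Φ ↔ g * y ∈ Φ) → x = y)
    (χ : AddChar (Additive G) ℂ) (hχ : χ (Additive.ofMul ρ) = -1) :
    ∑ s ∈ Φ, χ (Additive.ofMul s) ≠ 0 := by
  classical
  set m : ℕ := 2 ^ a with hm_def
  have hm : 0 < m := by positivity
  have hq1 : 1 < q := hq.one_lt
  have h2m : 2 * m = 2 ^ (a + 1) := by rw [hm_def, pow_succ, mul_comm]
  have hγ' : orderOf γ = 2 * m * q := by rw [h2m, hγ]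
  have hγ2 : orderOf γ = 2 * (m * q) := by rw [hγ', mul_assoc]
  have hcop : (2 * m).Coprime q := by
    rw [h2m]; exact Nat.Coprime.pow_left _ ((Nat.coprime_primes Nat.prime_two hq).2 (Ne.symm hq2))
  -- the involution `ρ = γ^{mq} = γ₂^m`
  have hρ1 : ρ ≠ 1 := by
    intro h; have := hΦ.rho_smul_ne (1 : G); rw [h, smul_eq_mul, one_mul] at this; exact this rfl
  have hρ2 : ρ * ρ = 1 := by have := hΦ.invol (1 : G); simpa [smul_eq_mul] using this
  have hρ : ρ = γ ^ (m * q) := involution_eq_pow hγ2 hgen hρ1 hρ2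
  -- `γ₂ = γ^q`, `γ_q = γ^(2m)`
  obtain ⟨γ₂, hγ₂⟩ : ∃ g : G, g = γ ^ q := ⟨_, rfl⟩
  obtain ⟨γq, hγq⟩ : ∃ g : G, g = γ ^ (2 * m) := ⟨_, rfl⟩
  have hρ' : ρ = γ₂ ^ m := by rw [hρ, hγ₂, ← pow_mul γ q m, mul_comm]
  have hγqq : γq ^ q = 1 := by
    rw [hγq, ← pow_mul γ (2 * m) q]
    exact orderOf_dvd_iff_pow_eq_one.1 (hγ' ▸ dvd_refl _)
  have hγq1 : γq ≠ 1 := by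
    rw [hγq]
    exact pow_ne_one_of_lt_orderOf (by positivity) (by rw [hγ']; nlinarith)
  -- `ω = χ(γ₂)`, `ζ = χ(γ_q)`
  set ω : ℂ := χ (Additive.ofMul γ₂) with hω_def
  set ζ : ℂ := χ (Additive.ofMul γq) with hζ_def
  have hχ2 : ∀ i j : ℕ, χ (Additive.ofMul (γ₂ ^ i * γq ^ j)) = ω ^ i * ζ ^ j := fun i j => by
    rw [ofMul_mul, AddChar.map_add_eq_mul, ofMul_pow, ofMul_pow, AddChar.map_nsmul_eq_pow,
      AddChar.map_nsmul_eq_pow]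
  have hωm : ω ^ m = -1 := by
    have := hχ2 m 0
    rw [pow_zero, mul_one, pow_zero, mul_one, ← hρ', hχ] at this
    exact this.symm
  have hζq : ζ ^ q = 1 := by
    have := hχ2 0 q
    rw [pow_zero, one_mul, pow_zero, one_mul, hγqq, ofMul_one, AddChar.map_zero_eq_one] at this
    exact this.symm
  -- signs
  let ε : ℕ → ℕ → ℚ := fun r s => if γ₂ ^ r * γq ^ s ∈ Φ then 1 else -1
  have hε : ∀ r s, ε r s = 1 ∨ ε r s = -1 := fun r s => by simp only [ε]; split_ifs <;> simp
  -- pairing under `ρ`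
  have hpair : ∀ r s : ℕ, (γ₂ ^ (r + m) * γq ^ s ∈ Φ ↔ γ₂ ^ r * γq ^ s ∉ Φ) := fun r s => by
    have h := hΦ.rho_smul_mem_iff (γ₂ ^ r * γq ^ s)
    rw [smul_eq_mul, hρ', ← mul_assoc, ← pow_add, add_comm, Finset.mem_coe, Finset.mem_coe] at h
    exact h
  -- reindexing `G` by `(Fin m × Fin q) ⊕ (Fin m × Fin q)`
  have hcardG : Fintype.card G = 2 * m * q := by
    have h := orderOf_eq_card_of_forall_mem_powers hgen
    rw [Nat.card_eq_fintype_card] at h; rw [← h, hγ']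
  let e : (Fin m × Fin q) ⊕ (Fin m × Fin q) → G := fun x =>
    Sum.elim (fun rs : Fin m × Fin q => γ₂ ^ (rs.1 : ℕ) * γq ^ (rs.2 : ℕ))
      (fun rs : Fin m × Fin q => γ₂ ^ ((rs.1 : ℕ) + m) * γq ^ (rs.2 : ℕ)) x
  have hpow : ∀ i j : ℕ, γ₂ ^ i * γq ^ j = γ ^ (q * i + 2 * m * j) := fun i j => by
    rw [hγ₂, hγq, ← pow_mul γ q i, ← pow_mul γ (2 * m) j, ← pow_add]
  have hinj : Function.Injective e := by
    rintro (rs | rs) (rs' | rs') h <;>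
      dsimp only [e, Sum.elim_inl, Sum.elim_inr] at h <;> rw [hpow, hpow] at h
    · have hb := rs.1.2; have hb' := rs'.1.2
      obtain ⟨h1, h2⟩ := exponents_eq_of_pow_eq hγ' hcop (by omega) (by omega) rs.2.2 rs'.2.2 h
      exact congrArg Sum.inl (Prod.ext (Fin.ext h1) (Fin.ext h2))
    · have hb := rs.1.2; have hb' := rs'.1.2
      obtain ⟨h1, -⟩ := exponents_eq_of_pow_eq hγ' hcop (by omega) (by omega) rs.2.2 rs'.2.2 h; omega
    · have hb := rs.1.2; have hb' := rs'.1.2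
      obtain ⟨h1, -⟩ := exponents_eq_of_pow_eq hγ' hcop (by omega) (by omega) rs.2.2 rs'.2.2 h; omega
    · have hb := rs.1.2; have hb' := rs'.1.2
      obtain ⟨h1, h2⟩ := exponents_eq_of_pow_eq hγ' hcop (by omega) (by omega) rs.2.2 rs'.2.2 h
      exact congrArg Sum.inr (Prod.ext (Fin.ext (by omega)) (Fin.ext h2))
  have hbij : Function.Bijective e := by
    rw [Fintype.bijective_iff_injective_and_card]
    refine ⟨hinj, ?_⟩
    rw [Fintype.card_sum, Fintype.card_prod, Fintype.card_fin, Fintype.card_fin, hcardG]; ring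
  -- the sum
  have hsum : ∑ s ∈ Φ, χ (Additive.ofMul s) =
      ∑ r ∈ Finset.range m, ∑ s ∈ Finset.range q, (ε r s : ℂ) * (ω ^ r * ζ ^ s) := by
    have h1 : ∑ s ∈ Φ, χ (Additive.ofMul s) = ∑ g : G, if g ∈ Φ then χ (Additive.ofMul g) else 0 := by
      rw [← Finset.sum_filter, Finset.filter_mem_eq_inter, Finset.univ_inter]
    have h2 : (∑ g : G, if g ∈ Φ then χ (Additive.ofMul g) else 0) =
        ∑ x : (Fin m × Fin q) ⊕ (Fin m × Fin q), if e x ∈ Φ then χ (Additive.ofMul (e x)) else 0 :=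
      (Fintype.sum_bijective e hbij (fun x => if e x ∈ Φ then χ (Additive.ofMul (e x)) else 0)
        (fun g => if g ∈ Φ then χ (Additive.ofMul g) else 0) fun _ => rfl).symm
    rw [h1, h2, Fintype.sum_sum_type, ← Finset.sum_add_distrib, Fintype.sum_prod_type, Finset.sum_range]
    refine Finset.sum_congr rfl fun r _ => ?_
    rw [Finset.sum_range]
    refine Finset.sum_congr rfl fun s _ => ?_
    change ((if γ₂ ^ (r : ℕ) * γq ^ (s : ℕ) ∈ Φ then χ (Additive.ofMul (γ₂ ^ (r : ℕ) * γq ^ (s : ℕ))) else 0) +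
        if γ₂ ^ ((r : ℕ) + m) * γq ^ (s : ℕ) ∈ Φ then χ (Additive.ofMul (γ₂ ^ ((r : ℕ) + m) * γq ^ (s : ℕ)))
        else 0) = (ε r s : ℂ) * (ω ^ (r : ℕ) * ζ ^ (s : ℕ))
    rw [hχ2, hχ2, pow_add ω (r : ℕ) m, hωm]
    by_cases hi : γ₂ ^ (r : ℕ) * γq ^ (s : ℕ) ∈ Φ
    · have hi' : γ₂ ^ ((r : ℕ) + m) * γq ^ (s : ℕ) ∉ Φ := fun h => (hpair r s).1 h hi
      simp only [hi, hi', if_true, if_false, ε]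
      push_cast; ring
    · have hi' : γ₂ ^ ((r : ℕ) + m) * γq ^ (s : ℕ) ∈ Φ := (hpair r s).2 hi
      simp only [hi, hi', if_true, if_false, ε]
      push_cast; ring
  rw [hsum]
  -- membership read on the signs
  have hmemε : ∀ r s : ℕ, (γ₂ ^ r * γq ^ s ∈ Φ ↔ ε r s = 1) := fun r s => by
    simp only [ε]
    split_ifs with h
    · simp [h]
    · simp only [h, false_iff]; norm_num
  rcases hq.eq_one_or_self_of_dvd (orderOf ζ) (orderOf_dvd_of_pow_eq_one hζq) with h1 | h2
  · -- `ζ = 1`: the coefficient of `ω^r` is a sum of `q` signs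
    have hζ1 : ζ = 1 := orderOf_eq_one_iff.1 h1
    simp only [hζ1, one_pow, mul_one]
    let P : ℚ[X] := ∑ r ∈ Finset.range m, monomial r (∑ s ∈ Finset.range q, ε r s)
    have hP0 : P ≠ 0 := by
      intro h
      have h0 : P.coeff 0 = ∑ s ∈ Finset.range q, ε 0 s := by
        simp only [P, finsetSum_coeff, coeff_monomial]
        rw [Finset.sum_eq_single 0 (fun i _ hi => if_neg hi) (fun h => absurd (Finset.mem_range.2 hm) h),
          if_pos rfl]
      rw [h, coeff_zero] at h0
      exact sum_signs_ne_zero (hq.odd_of_ne_two hq2) (ε 0) (hε 0) h0.symm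
    have hPdeg : P.natDegree < m := by
      have h1 : P.natDegree ≤ m - 1 :=
        natDegree_sum_le_of_forall_le _ _ fun i hi =>
          (natDegree_monomial_le _).trans (by have := Finset.mem_range.1 hi; omega)
      omega
    have hPeval : aeval ω P = ∑ r ∈ Finset.range m, ∑ s ∈ Finset.range q, (ε r s : ℂ) * ω ^ r := by
      simp only [P, map_sum, aeval_monomial, eq_ratCast]
    rw [← hPeval]
    exact aeval_ne_zero_of_pow_eq_neg_one hm_def hωm hP0 hPdeg
  · -- `ζ` a primitive `q`-th root: the signs do not depend on `s`, so `Φ` is `γ_q`-stable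
    have hζprim : IsPrimitiveRoot ζ q := IsPrimitiveRoot.iff_orderOf.2 h2
    intro h0
    have hconst := forall_eq_of_sum_monomials_eq_zero hm_def hωm hq hq2 hζprim ε h0
    -- membership of `γ₂^r γq^s`, `r < m`, does not depend on `s`
    have hlow : ∀ r < m, ∀ s s' : ℕ, (γ₂ ^ r * γq ^ s ∈ Φ ↔ γ₂ ^ r * γq ^ s' ∈ Φ) := by
      intro r hr s s'
      rw [pow_eq_pow_mod s hγqq, pow_eq_pow_mod s' hγqq, hmemε, hmemε,
        hconst r hr _ (Nat.mod_lt _ (by omega)), hconst r hr _ (Nat.mod_lt _ (by omega))]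
    have hall : ∀ g : G, (g ∈ Φ ↔ g * γq ∈ Φ) := by
      intro g
      obtain ⟨x, rfl⟩ := hbij.2 g
      rcases x with ⟨r, s⟩ | ⟨r, s⟩
      · change (γ₂ ^ (r : ℕ) * γq ^ (s : ℕ) ∈ Φ ↔ γ₂ ^ (r : ℕ) * γq ^ (s : ℕ) * γq ∈ Φ)
        rw [mul_assoc, ← pow_succ]
        exact hlow r r.2 _ _
      · change (γ₂ ^ ((r : ℕ) + m) * γq ^ (s : ℕ) ∈ Φ ↔ γ₂ ^ ((r : ℕ) + m) * γq ^ (s : ℕ) * γq ∈ Φ)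
        rw [mul_assoc, ← pow_succ, hpair, hpair, hlow r r.2 (s : ℕ) ((s : ℕ) + 1)]
    have h1q : (1 : G) = γq := hprim 1 γq fun g => by rw [mul_one]; exact hall g
    exact hγq1 h1q.symm

end Group

end Literature.AlgebraicGeometry.ComplexMultiplication.CyclicTwoPower

end
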